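/-
Copyright (c) 2026. All rights reserved.
Released under Apache 2.0 license as described in the file LICENSE.
Authors: abc-iut cell, block C / W6 seat abc-iut-w6-d105 (gen 5).
-/
import Literature.IUT.LogVolume.RescaledCompletionInvariants
import Literature.IUT.LogVolume.LocalDegreeBridge
import Literature.IUT.LogVolume.DepthConstantsBound
import HarnessLib

/-!
# `e(K_w/ℚ_p) ≤ [K_w : ℚ_p] ≤ [K : ℚ]`: the local degree of a completion is bounded by the global degree, and
# the [IUTchIV] Prop. 1.2 constants at ANY place are bounded by the global degree alone (proof-only)

Classical algebraic number theory (Neukirch, *Algebraic Number Theory*, Ch. II Prop. (6.8): `[K_w : ℚ_p] = e_w f_w`;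
Ch. I Prop. (8.2): `Σ_{w ∣ p} e_w f_w = [K : ℚ]`), assembled from what the tree already proves, in the two
currencies of the `[IUTchIV] §1` files:

* §1 — for ANY field `K` of the "MLF class" of `RamificationInvariants.lean` (a proper ultrametric nontrivially normed
  `ℚ_p`-algebra; e.g. abc-iut-S7's `RescaledCompletion`): `0 < [K : ℚ_p]`, `e ∣ [K : ℚ_p]`, `f ∣ [K : ℚ_p]`,
  `f ≤ [K : ℚ_p]` (the companion `e ≤ [K : ℚ_p]` is `absRamificationIdx_le_finrank` of `DepthConstantsBound.lean`) —
  immediate from abc-iut-S1's fundamental identity `absRamificationIdx_mul_residueDegree : e·f = [K : ℚ_p]`;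
* §2 — for a number field `F` and a finite place `v ∣ p`: `localDeg F v ≤ [F : ℚ]` (one term of abc-iut-L5-t5's
  `sum_localDeg : Σ_{v ∣ p} localDeg F v = [F : ℚ]`), hence for the rescaled completion `F_v = RescaledCompletion F p v hv`:
  `[F_v : ℚ_p] = localDeg F v ≤ [F : ℚ]`, `e(F_v) ≤ [F : ℚ]`, `f(F_v) ≤ [F : ℚ]`, with the real-valued / `log_p` / `v_p`
  forms in which such bounds are consumed (`v_p([F_v : ℚ_p]) ≤ log_p [F : ℚ]`, the shape of the last summand of
  `differentOrd_lt` at `k₀ = ℚ_p`);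
* §3 — the composition with `depthConstants_lt` (`DepthConstantsBound.lean`, `d + a + b < 4 + 2·log_p [K : ℚ_p]`):
  **`d(F_v) + a(F_v) + b(F_v) < 4 + 2·log_p [F : ℚ]`** for `p > 2`, at EVERY place `v ∣ p` — the exponent constants of
  [IUTchIV] Prop. 1.2 at a completion are bounded by the GLOBAL degree alone.

Proof-only (no definition, no named fact, no instance); nothing here bears on the disputed parts of the IUT corpus
(the [IUTchIV] locators of the imported files only record where the text prints `e, f, d, a, b`).
[cite: NeukirchANT1999, Ch. II Prop. (6.8); Ch. I Prop. (8.2)]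
-/

noncomputable section

open NumberField IsDedekindDomain Module
open Literature.NumberTheory.NumberFields

namespace Literature.IUT.LogVolume

/-! ## §1. Any `K` of the MLF class: `0 < [K : ℚ_p]`, `e, f ∣ [K : ℚ_p]`, `f ≤ [K : ℚ_p]` -/

section Generic

variable (p : ℕ) [Fact p.Prime]
variable (K : Type*) [NontriviallyNormedField K] [instK : NormedAlgebra ℚ_[p] K] [IsUltrametricDist K]
  [ProperSpace K]

/-- `0 < [K : ℚ_p]` (indeed `[K : ℚ_p] = e·f` with `e, f ≥ 1`). [cite: NeukirchANT1999, Ch. II Prop. (6.8)] -/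
theorem finrank_padic_pos : 0 < finrank ℚ_[p] K := by
  rw [← absRamificationIdx_mul_residueDegree p K]
  exact Nat.mul_pos (absRamificationIdx_pos p K) (residueDegree_pos p K)

/-- **`e ∣ [K : ℚ_p]`.** [cite: NeukirchANT1999, Ch. II Prop. (6.8)] -/
theorem absRamificationIdx_dvd_finrank : absRamificationIdx p K ∣ finrank ℚ_[p] K :=
  Dvd.intro _ (absRamificationIdx_mul_residueDegree p K)

/-- **`f ∣ [K : ℚ_p]`.** [cite: NeukirchANT1999, Ch. II Prop. (6.8)] -/
theorem residueDegree_dvd_finrank : residueDegree p K ∣ finrank ℚ_[p] K :=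
  Dvd.intro_left _ (absRamificationIdx_mul_residueDegree p K)

/-- **`f(K/ℚ_p) ≤ [K : ℚ_p]`** (companion of `absRamificationIdx_le_finrank`). [cite: NeukirchANT1999, Ch. II Prop. (6.8)] -/
theorem residueDegree_le_finrank : residueDegree p K ≤ finrank ℚ_[p] K :=
  Nat.le_of_dvd (finrank_padic_pos p K) (residueDegree_dvd_finrank p K)

/-- `e ≤ [K : ℚ_p]`, as real numbers. [cite: NeukirchANT1999, Ch. II Prop. (6.8)] -/
theorem absRamificationIdx_cast_le_finrank : (absRamificationIdx p K : ℝ) ≤ (finrank ℚ_[p] K : ℝ) := by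
  exact_mod_cast absRamificationIdx_le_finrank p K

omit [IsUltrametricDist K] [ProperSpace K] in
/-- `v_p([K : ℚ_p]) ≤ log_p [K : ℚ_p]` (integer logarithm) — the shape of the last summand of `differentOrd_lt`
at `k₀ = ℚ_p`. [cite: NeukirchANT1999, Ch. II Prop. (6.8)] -/
theorem padicValNat_finrank_le_log : padicValNat p (finrank ℚ_[p] K) ≤ Nat.log p (finrank ℚ_[p] K) :=
  padicValNat_le_nat_log _

/-- `d + a + b < 4 + 2·log_p N` for `p > 2` and ANY real `N ≥ [K : ℚ_p]`: `depthConstants_lt` is monotone in the degree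
(the form in which a GLOBAL degree bound is substituted). [cite: NeukirchANT1999, Ch. II Prop. (6.8)] -/
theorem depthConstants_lt_of_finrank_le (hp : 2 < p) {N : ℝ} (hN : (finrank ℚ_[p] K : ℝ) ≤ N) :
    differentOrd p K + logRadiusA p (absRamificationIdx p K) + logRadiusB p (absRamificationIdx p K) <
      4 + 2 * Real.logb p N := by
  have h := depthConstants_lt p K hp
  have hpR : (1 : ℝ) < p := by exact_mod_cast (show 1 < p by omega)
  have hle : Real.logb p (finrank ℚ_[p] K) ≤ Real.logb p N :=
    Real.logb_le_logb_of_le hpR (by exact_mod_cast finrank_padic_pos p K) hN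
  linarith

end Generic

/-! ## §2. A number field `F` and a finite place `v ∣ p`: everything is bounded by `[F : ℚ]` -/

section NumberField

variable (F : Type) [Field F] [NumberField F] (p : ℕ) [Fact p.Prime] (v : HeightOneSpectrum (𝓞 F))
  (hv : ((p : ℕ) : 𝓞 F) ∈ v.asIdeal)

/-- **`n_v = e_v f_v ≤ [F : ℚ]`**: one term of the fundamental identity `Σ_{v' ∣ p_v} n_{v'} = [F : ℚ]`
(`sum_localDeg` at the residue characteristic of `v`). [cite: NeukirchANT1999, Ch. I Prop. (8.2)] -/
theorem localDeg_le_finrank_rat : localDeg F v ≤ finrank ℚ F := by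
  haveI : Fact (residueChar F v).Prime := ⟨residueChar_prime F v⟩
  rw [← sum_localDeg F (residueChar F v)]
  exact Finset.single_le_sum (f := fun w => localDeg F w) (fun _ _ => Nat.zero_le _)
    (mem_placesOver_residueChar v)

/-- `e(v | p) ≤ n_v`. [cite: NeukirchANT1999, Ch. II Prop. (6.8)] -/
theorem ramificationIdx_int_le_localDeg : v.asIdeal.ramificationIdx ℤ ≤ localDeg F v :=
  Nat.le_mul_of_pos_right _ (Ideal.inertiaDeg_pos _ _)

/-- `f(v | p) ≤ n_v`. [cite: NeukirchANT1999, Ch. II Prop. (6.8)] -/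
theorem inertiaDeg_int_le_localDeg : v.asIdeal.inertiaDeg ℤ ≤ localDeg F v :=
  Nat.le_mul_of_pos_left _ (Ideal.ramificationIdx_pos _ _)

/-- `f(v | p) ≤ [F : ℚ]` (the `e`-companion is `ramificationIdx_int_le_finrank_rat` of `GenuineRamificationBounds.lean`).
[cite: NeukirchANT1999, Ch. I Prop. (8.2)] -/
theorem inertiaDeg_int_le_finrank_rat : v.asIdeal.inertiaDeg ℤ ≤ finrank ℚ F :=
  (inertiaDeg_int_le_localDeg F v).trans (localDeg_le_finrank_rat F v)

/-- **`[F_v : ℚ_p] = n_v`** for the rescaled completion (abc-iut-S7's `RescaledCompletion.localDeg_eq_finrank`, read on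
the type synonym). [cite: NeukirchANT1999, Ch. II Prop. (6.8)] -/
theorem finrank_rescaledCompletion_eq_localDeg :
    finrank ℚ_[p] (RescaledCompletion F p v hv) = localDeg F v :=
  (RescaledCompletion.localDeg_eq_finrank F p v hv).symm

/-- **`[F_v : ℚ_p] ≤ [F : ℚ]`.** [cite: NeukirchANT1999, Ch. I Prop. (8.2)] -/
theorem finrank_rescaledCompletion_le_finrank_rat :
    finrank ℚ_[p] (RescaledCompletion F p v hv) ≤ finrank ℚ F := by
  rw [finrank_rescaledCompletion_eq_localDeg F p v hv]
  exact localDeg_le_finrank_rat F v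

/-- **`e(F_v/ℚ_p) ≤ [F_v : ℚ_p]`** (the norm-defined ramification index of `RamificationInvariants.lean`).
[cite: NeukirchANT1999, Ch. II Prop. (6.8)] -/
theorem absRamificationIdx_rescaledCompletion_le_finrank_padic :
    absRamificationIdx p (RescaledCompletion F p v hv) ≤ finrank ℚ_[p] (RescaledCompletion F p v hv) :=
  absRamificationIdx_le_finrank p _

/-- **`e(F_v/ℚ_p) ≤ [F : ℚ]`.** [cite: NeukirchANT1999, Ch. I Prop. (8.2)] -/
theorem absRamificationIdx_rescaledCompletion_le_finrank_rat :
    absRamificationIdx p (RescaledCompletion F p v hv) ≤ finrank ℚ F :=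
  (absRamificationIdx_le_finrank p _).trans (finrank_rescaledCompletion_le_finrank_rat F p v hv)

/-- `f(F_v/ℚ_p) ≤ [F : ℚ]` (the norm-defined residue degree). [cite: NeukirchANT1999, Ch. I Prop. (8.2)] -/
theorem residueDegree_rescaledCompletion_le_finrank_rat :
    residueDegree p (RescaledCompletion F p v hv) ≤ finrank ℚ F :=
  (residueDegree_le_finrank p _).trans (finrank_rescaledCompletion_le_finrank_rat F p v hv)

/-- `0 < [F_v : ℚ_p]`. [cite: NeukirchANT1999, Ch. II Prop. (6.8)] -/
theorem finrank_rescaledCompletion_pos : 0 < finrank ℚ_[p] (RescaledCompletion F p v hv) :=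
  finrank_padic_pos p _

/-! ### Real-valued, `v_p` and `log_p` forms -/

/-- `e(F_v/ℚ_p) ≤ [F : ℚ]`, as real numbers. [cite: NeukirchANT1999, Ch. I Prop. (8.2)] -/
theorem absRamificationIdx_rescaledCompletion_cast_le_finrank_rat :
    (absRamificationIdx p (RescaledCompletion F p v hv) : ℝ) ≤ (finrank ℚ F : ℝ) := by
  exact_mod_cast absRamificationIdx_rescaledCompletion_le_finrank_rat F p v hv

/-- `[F_v : ℚ_p] ≤ [F : ℚ]`, as real numbers. [cite: NeukirchANT1999, Ch. I Prop. (8.2)] -/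
theorem finrank_rescaledCompletion_cast_le_finrank_rat :
    (finrank ℚ_[p] (RescaledCompletion F p v hv) : ℝ) ≤ (finrank ℚ F : ℝ) := by
  exact_mod_cast finrank_rescaledCompletion_le_finrank_rat F p v hv

/-- `v_p([F_v : ℚ_p]) ≤ log_p [F : ℚ]` (integer logarithm): `v_p(n) ≤ log_p n` and `n_v ≤ [F : ℚ]`.
[cite: NeukirchANT1999, Ch. I Prop. (8.2)] -/
theorem padicValNat_finrank_rescaledCompletion_le_log_finrank_rat :
    padicValNat p (finrank ℚ_[p] (RescaledCompletion F p v hv)) ≤ Nat.log p (finrank ℚ F) :=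
  (padicValNat_le_nat_log _).trans (Nat.log_mono_right (finrank_rescaledCompletion_le_finrank_rat F p v hv))

/-- **`v_p([F_v : ℚ_p]) ≤ log_p [F : ℚ]`** with the REAL base-`p` logarithm on the right — the form in which the
`v_p([K : ℚ_p])`-summand of `differentOrd_lt` (at `k₀ = ℚ_p`) is bounded by the global degree.
[cite: NeukirchANT1999, Ch. I Prop. (8.2)] -/
theorem padicValNat_finrank_rescaledCompletion_cast_le_logb_finrank_rat :
    (padicValNat p (finrank ℚ_[p] (RescaledCompletion F p v hv)) : ℝ) ≤ Real.logb p (finrank ℚ F) :=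
  calc (padicValNat p (finrank ℚ_[p] (RescaledCompletion F p v hv)) : ℝ)
      ≤ (Nat.log p (finrank ℚ F) : ℝ) := by
        exact_mod_cast padicValNat_finrank_rescaledCompletion_le_log_finrank_rat F p v hv
    _ ≤ Real.logb p (finrank ℚ F) := Real.natLog_le_logb _ _

/-- `log_p e(F_v/ℚ_p) ≤ log_p [F : ℚ]` (real base-`p` logarithms; `e ≥ 1`). [cite: NeukirchANT1999, Ch. I Prop. (8.2)] -/
theorem logb_absRamificationIdx_rescaledCompletion_le :
    Real.logb p (absRamificationIdx p (RescaledCompletion F p v hv)) ≤ Real.logb p (finrank ℚ F) :=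
  Real.logb_le_logb_of_le (by exact_mod_cast (Fact.out : p.Prime).one_lt)
    (by exact_mod_cast absRamificationIdx_pos p (RescaledCompletion F p v hv))
    (absRamificationIdx_rescaledCompletion_cast_le_finrank_rat F p v hv)

/-- `log_p [F_v : ℚ_p] ≤ log_p [F : ℚ]` (real base-`p` logarithms). [cite: NeukirchANT1999, Ch. I Prop. (8.2)] -/
theorem logb_finrank_rescaledCompletion_le :
    Real.logb p (finrank ℚ_[p] (RescaledCompletion F p v hv)) ≤ Real.logb p (finrank ℚ F) :=
  Real.logb_le_logb_of_le (by exact_mod_cast (Fact.out : p.Prime).one_lt)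
    (by exact_mod_cast finrank_rescaledCompletion_pos F p v hv)
    (finrank_rescaledCompletion_cast_le_finrank_rat F p v hv)

/-! ## §3. The [IUTchIV] Prop. 1.2 constants at a place `v ∣ p`, `p > 2`, are bounded by the GLOBAL degree -/

/-- **`d(F_v) + a(F_v) + b(F_v) < 4 + 2·log_p [F : ℚ]`** for `p > 2`, at EVERY finite place `v ∣ p` of the number field
`F`: `depthConstants_lt` (`d + a + b < 4 + 2·log_p [F_v : ℚ_p]`, Lenstra's different bound + `a ≤ 2` + `b ≤ 1 + log_p e`)
composed with `[F_v : ℚ_p] ≤ [F : ℚ]`. [cite: NeukirchANT1999, Ch. I Prop. (8.2)] -/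
theorem depthConstants_rescaledCompletion_lt (hp : 2 < p) :
    differentOrd p (RescaledCompletion F p v hv)
        + logRadiusA p (absRamificationIdx p (RescaledCompletion F p v hv))
        + logRadiusB p (absRamificationIdx p (RescaledCompletion F p v hv)) <
      4 + 2 * Real.logb p (finrank ℚ F) :=
  depthConstants_lt_of_finrank_le p (RescaledCompletion F p v hv) hp
    (finrank_rescaledCompletion_cast_le_finrank_rat F p v hv)

/-- The same with ANY real `N ≥ [F : ℚ]` on the right (the form in which a bound on the global degree — e.g. the
degree of a torsion field over its field of moduli — is substituted). [cite: NeukirchANT1999, Ch. I Prop. (8.2)] -/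
theorem depthConstants_rescaledCompletion_lt_of_finrank_le (hp : 2 < p) {N : ℝ} (hN : (finrank ℚ F : ℝ) ≤ N) :
    differentOrd p (RescaledCompletion F p v hv)
        + logRadiusA p (absRamificationIdx p (RescaledCompletion F p v hv))
        + logRadiusB p (absRamificationIdx p (RescaledCompletion F p v hv)) <
      4 + 2 * Real.logb p N :=
  depthConstants_lt_of_finrank_le p (RescaledCompletion F p v hv) hp
    ((finrank_rescaledCompletion_cast_le_finrank_rat F p v hv).trans hN)

end NumberField

end Literature.IUT.LogVolume

end
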